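import Summits.QuantumFields.YangMills.Theorems.BalabanLadderIRHeavyTwistWallSectorChain
import Summits.QuantumFields.YangMills.Theorems.BalabanLadderIRHeavyTwistWallSliceFourier
import Summits.QuantumFields.YangMills.Theorems.BalabanLadderIRHeavyTwistWallPolyakovSlices
import Literature.MathematicalPhysics.QuantumFieldTheory.WilsonFinTorusTwistedPartitionSwap
import Literature.Barriers.QuantumFields.FiniteTemperatureInfraredExplicitProofs
import Literature.Barriers.QuantumFields.FiniteTemperaturePolyakovDiagonal
import Literature.Barriers.QuantumFields.FiniteTemperatureInfraredConvexity
import HarnessLib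

/-!
# The heavy-twist WINDOW: Borgs–Seiler's finite-volume infrared bound bounds the temporal ℤ₂-twist ratio of even cold boxes

HELPER 6/6 (the engine) for the crux `BalabanLadder.IR` (stmt-QuantumFields-19354), line `heavy-twist` RUNG 2 on even boxes (wall
seat `ym-ir-wall-p1`; recipe ym-ir-crit-3 2026-08-28T07:11:56Z).  ASSEMBLY of kernel-closed pieces, no physics stub:

* reading B of the twisted partition function (`wilsonFinTorusTwistedPartition_swap03_update`, lit-4): the `(0,3)`-twisted box
  `L³ × T` read along axis `0` is the box `T × L × L × L` sliced along its last axis (period `L`), the twist being 't Hooft's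
  centre operator `finSliceTwist` on slice `0`, under which the slice Polyakov magnetisation `m` is ODD (`ρ(c) = −1`);
* the kernel-level sector Cauchy–Schwarz `sector_bound_chain` (helpers 1–2): `X² ≤ 2B²W(Z − Zᵀ)`;
* the dictionaries (helper 5, lit-4 parts 5–6): `X/Z = L² S(L/2)`, `W/Z = L² S(0)`, `S(s) = Σ_w G_L(s ∷ w)`, `G_L` = Borgs–Seiler's
  Polyakov two-point function of the finite-temperature box (`L₀ = T`);
* the TREE THEOREMS `BorgsSeilerInfraredBoundExplicit_holds` (finite-volume infrared bound, rate `f = (1 + 2N/β)^T − 1`, even `L ≥ 4`),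
  `FiniteTemperature.one_le_polyakovCorrelation_zero` (`G_L(0) ≥ 1`), `polyakovCorrelation_posSemidef` (`Re Ĝ ≥ 0`);
* the finite Fourier inputs (helpers 3–4): `torusGreen 0 ≤ 13/8`, `S(0) ≤ L²(m² + f/8)`, `S(s) ≥ L²(m² − f/8)`, `m² ≥ 1 − 39f/8`.

MAIN (`twistRatio_le_of_rate`): for a compact group `G`, a continuous faithful unitary `N`-dimensional `ρ` with REAL characters, a
central `c` with `ρ(c) = −1`, `c² = 1`, every `β > 0`, every EVEN `L = 2n + 2 ≥ 4` and every temporal extent `T ≥ 1` with `5f < 1`: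

  `Z^{(c on (0,3))}_β(L,L,L,T) / Z_β(L,L,L,T) ≤ 1 − (1 − 5f)² / (2N²(1 − 19f/4))`,  `f = (1 + 2N/β)^T − 1`.

HONEST FRAMING: a finite-box inequality in the LINEAR Borgs–Seiler window (β ≳ N T); it is the engine of a NEGATIVE (wall) theorem about
the seed `E` of `BalabanLadder.IR` (width 0 toward IR) and proves neither `IR`, nor `E`, nor the Yang–Mills mass gap (Clay); R4 closes only
`BalabanLadder.UV`.  References: C. Borgs, E. Seiler, Commun. Math. Phys. 91 (1983) 329 (Lemma II.6–II.8, Lemma III.6, Cor. III.7);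
G. 't Hooft, Nucl. Phys. B 153 (1979) 141; E. T. Tomboulis, L. G. Yaffe, Commun. Math. Phys. 100 (1985) 313.
-/

set_option autoImplicit false

noncomputable section

open MeasureTheory Filter Finset
open scoped ComplexConjugate
open Literature.MathematicalPhysics.QuantumFieldTheory Literature.Barriers.QuantumFields
open Literature.Barriers.QuantumFields.FiniteTemperature
open Literature.Probability.LatticeModels (TorusSite torusFourier torusGreen latticeMomentum dispersion)

namespace Summit.QuantumFields.YangMills.Cruxes.IR.HeavyTwistWall

section Data

variable {G : Type*} [Group G] [TopologicalSpace G] [IsTopologicalGroup G] [CompactSpace G] [MeasurableSpace G] [BorelSpace G]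
  {N : ℕ} (ρ : G →* Matrix (Fin N) (Fin N) ℂ)

omit [TopologicalSpace G] [IsTopologicalGroup G] [CompactSpace G] [MeasurableSpace G] [BorelSpace G] in
/-- **The slice magnetisation of a unitary `N`-dimensional representation is bounded by `N · b₂ b₃`** (`|Re tr ρ(g)| ≤ N`). -/
theorem abs_finSliceMagnetisation_le (hρu : ∀ g, ρ g ∈ Matrix.unitaryGroup (Fin N) ℂ) {b₁ b₂ b₃ : ℕ}
    (a : FinSpatialSite b₁ b₂ b₃ × Fin 3 → G) :
    ‖finSliceMagnetisation ρ a‖ ≤ (N : ℝ) * ((b₂ : ℝ) * b₃) := by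
  rw [finSliceMagnetisation_eq_sum]
  calc ‖∑ q : Fin b₂ × Fin b₃, (ρ (finSlicePolyakovHolonomy a q)).trace.re‖
      ≤ ∑ q : Fin b₂ × Fin b₃, ‖(ρ (finSlicePolyakovHolonomy a q)).trace.re‖ := norm_sum_le _ _
    _ ≤ ∑ _q : Fin b₂ × Fin b₃, (N : ℝ) := Finset.sum_le_sum fun q _ =>
        (Complex.abs_re_le_norm _).trans (norm_trace_le_of_mem_unitaryGroup (hρu _))
    _ = (N : ℝ) * ((b₂ : ℝ) * b₃) := by
        rw [Finset.sum_const, Finset.card_univ, Fintype.card_prod, Fintype.card_fin, Fintype.card_fin, nsmul_eq_mul]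
        push_cast; ring

omit [TopologicalSpace G] [IsTopologicalGroup G] [CompactSpace G] [MeasurableSpace G] [BorelSpace G] in
/-- An involutive central twist: for `c² = 1`, `finSliceTwist (update 1 0 c)` is an involution. -/
theorem finSliceTwist_update_involutive {c : G} (hcc : c * c = 1) {b₁ b₂ b₃ : ℕ} (a : FinSpatialSite b₁ b₂ b₃ × Fin 3 → G) :
    finSliceTwist (Function.update (1 : Fin 4 → G) 0 c) (finSliceTwist (Function.update (1 : Fin 4 → G) 0 c) a) = a := by
  rw [finSliceTwist_finSliceTwist]
  have h1 : Function.update (1 : Fin 4 → G) 0 c * Function.update (1 : Fin 4 → G) 0 c = 1 := by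
    funext i
    by_cases hi : i = 0
    · subst hi; simp [hcc]
    · simp [Function.update_of_ne hi]
  rw [h1, finSliceTwist_one]
  rfl

end Data

/-! ## Step A — the sector inequality for the Wilson cold box read along a long axis -/

section SectorStep

variable {G : Type*} [Group G] [TopologicalSpace G] [IsTopologicalGroup G] [CompactSpace G] [MeasurableSpace G] [BorelSpace G]
  [SecondCountableTopology G] {N : ℕ} (ρ : G →* Matrix (Fin N) (Fin N) ℂ)

/-- **Step A (sector inequality, model level).**  For continuous unitary `ρ`, a central `c` with `ρ(c) = −1` and `c² = 1`, the
box `T × L × L × L` with `L = 2n + 2` sliced along its last axis, `m` the slice magnetisation, `p = n + 1` the antipodal slice: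
`x² ≤ 2 (N L²)² · w · (1 − r)` where `x = ⟨m(𝒰₀) m(𝒰_p)⟩`, `w = ⟨m(𝒰₀)²⟩` (expectations in the box `T × L × L × L`) and
`r = Z^{(c on (0,3))}(L,L,L,T)/Z(L,L,L,T)` is the temporal-twist ratio of the ORIGINAL cold box (reading B + `sector_bound_chain`). -/
theorem sq_corr_le_of_sector (hρ : Continuous ρ) (hρu : ∀ g, ρ g ∈ Matrix.unitaryGroup (Fin N) ℂ) {c : G}
    (hc : c ∈ Subgroup.center G) (hρc : ρ c = -1) (hcc : c * c = 1) (β : ℝ) (n T : ℕ) [NeZero T] :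
    (finTorusExpectation ρ β (fun V' : FinTorusSite T (n + 1 + n + 1) (n + 1 + n + 1) (n + 1 + n + 1) × Fin 4 → G =>
        finSliceMagnetisation ρ (finTorusSlice V' 0) *
          finSliceMagnetisation ρ (finTorusSlice V' ⟨n + 1, by omega⟩))) ^ 2 ≤
      2 * ((N : ℝ) * (((n + 1 + n + 1 : ℕ) : ℝ) * ((n + 1 + n + 1 : ℕ) : ℝ))) ^ 2 *
        finTorusExpectation ρ β (fun V' : FinTorusSite T (n + 1 + n + 1) (n + 1 + n + 1) (n + 1 + n + 1) × Fin 4 → G =>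
          finSliceMagnetisation ρ (finTorusSlice V' 0) ^ 2) *
        (1 - wilsonFinTorusTwistedPartition ρ β (Function.update (1 : Fin 4 → G) 0 c)
              (n + 1 + n + 1) (n + 1 + n + 1) (n + 1 + n + 1) T /
            wilsonFinTorusPartition ρ β (n + 1 + n + 1) (n + 1 + n + 1) (n + 1 + n + 1) T) := by
  set L : ℕ := n + 1 + n + 1 with hL
  -- the slices of the exchanged box `T × L × L × L`, their measure, kernel, twist and magnetisation
  set μ : Measure (FinSpatialSite T L L × Fin 3 → G) := Measure.pi fun _ => haarProbability G with hμ
  set K : (FinSpatialSite T L L × Fin 3 → G) → (FinSpatialSite T L L × Fin 3 → G) → ℝ := finTorusSliceKernel ρ β with hK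
  set z : Fin 4 → G := Function.update (1 : Fin 4 → G) 0 c with hz
  set Tw : (FinSpatialSite T L L × Fin 3 → G) → (FinSpatialSite T L L × Fin 3 → G) := finSliceTwist z with hTw
  set mag : (FinSpatialSite T L L × Fin 3 → G) → ℝ := finSliceMagnetisation ρ with hmag
  have hcinv : c⁻¹ = c := inv_eq_of_mul_eq_one_right hcc
  have hzc : ∀ i : Fin 3, z i.castSucc ∈ Subgroup.center G := by
    intro i
    by_cases hi : i.castSucc = (0 : Fin 4)
    · rw [hz, hi, Function.update_self]; exact hc
    · rw [hz, Function.update_of_ne hi]; exact Subgroup.one_mem _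
  -- kernel data
  have hKm : Measurable (Function.uncurry K) := (stronglyMeasurable_uncurry_finTorusSliceKernel ρ hρ β).measurable
  obtain ⟨C, hC⟩ := exists_norm_finTorusSliceKernel_le (b₁ := T) (b₂ := L) (b₃ := L) ρ hρ β
  have hKsymm : ∀ a b, K a b = K b a := finTorusSliceKernel_symm ρ hρu β
  -- twist data
  have hTmp : MeasurePreserving Tw μ μ := measurePreserving_finSliceTwist z
  have hTm : Measurable Tw := hTmp.measurable
  have hTT : ∀ a, Tw (Tw a) = a := fun a => finSliceTwist_update_involutive hcc a
  -- magnetisation data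
  have hfm : Measurable mag := measurable_finSliceMagnetisation ρ hρ
  have hfb : ∀ a, ‖mag a‖ ≤ (N : ℝ) * ((L : ℝ) * L) := fun a => abs_finSliceMagnetisation_le ρ hρu a
  have hneg : ρ (z 0) = -1 := by rw [hz, Function.update_self]; exact hρc
  have hfT : ∀ a, mag (Tw a) = -mag a := fun a => finSliceMagnetisation_finSliceTwist_of_eq_neg_one ρ hneg a
  -- the abstract sector bound on the even cycle of `L = (n+1)+(n+1)` slices
  set p : Fin (n + 1 + n + 1) := ⟨n + 1, by omega⟩ with hp
  have hsec := (sector_bound_chain (ρ := μ) hKm hC hKsymm hTm hTmp hTT hfm hfb hfT n p rfl).1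
  -- identify the four chains with the Wilson integrals
  have hZ : wilsonFinTorusPartition ρ β T L L L = ∫ V : Fin (n + 1 + n + 1) → (FinSpatialSite T L L × Fin 3 → G),
      ∏ t, K (V t) (V (t + 1)) ∂(Measure.pi fun _ => μ) := by
    have h := integral_sliceObs_two_mul_finTorusWeight ρ hρ β T L L (n + 1 + n) p (F₁ := fun _ => (1 : ℝ))
      (F₂ := fun _ => (1 : ℝ)) measurable_const measurable_const (B₁ := 1) (B₂ := 1) (fun _ => by simp) (fun _ => by simp)
    simp only [one_mul] at h
    rw [wilsonFinTorusPartition_eq_integral_finTorusTwistedWeight_one, h]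
  have hmc : Continuous mag := continuous_finSliceMagnetisation ρ hρ
  have hX : wilsonFinTorusPartition ρ β T L L L *
      finTorusExpectation ρ β (fun V' : FinTorusSite T L L L × Fin 4 → G =>
        mag (finTorusSlice V' 0) * mag (finTorusSlice V' p)) =
      ∫ V : Fin (n + 1 + n + 1) → (FinSpatialSite T L L × Fin 3 → G), mag (V 0) * mag (V p) * ∏ t, K (V t) (V (t + 1))
        ∂(Measure.pi fun _ => μ) := by
    rw [wilsonFinTorusPartition_mul_finTorusExpectation ρ hρ β]
    exact integral_sliceObs_two_mul_finTorusWeight ρ hρ β T L L (n + 1 + n) p hfm hfm hfb hfb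
  have hW : wilsonFinTorusPartition ρ β T L L L *
      finTorusExpectation ρ β (fun V' : FinTorusSite T L L L × Fin 4 → G => mag (finTorusSlice V' 0) ^ 2) =
      ∫ V : Fin (n + 1 + n + 1) → (FinSpatialSite T L L × Fin 3 → G), mag (V 0) ^ 2 * ∏ t, K (V t) (V (t + 1))
        ∂(Measure.pi fun _ => μ) := by
    rw [wilsonFinTorusPartition_mul_finTorusExpectation ρ hρ β]
    have h := integral_sliceObs_two_mul_finTorusWeight ρ hρ β T L L (n + 1 + n) p (F₁ := fun a => mag a ^ 2)
      (F₂ := fun _ => (1 : ℝ)) (hfm.pow_const 2) measurable_const (B₁ := ((N : ℝ) * ((L : ℝ) * L)) ^ 2) (B₂ := 1)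
      (fun a => by rw [norm_pow]; exact pow_le_pow_left₀ (norm_nonneg _) (hfb a) 2) (fun _ => by simp)
    simp only [mul_one] at h
    exact h
  have hZtw : wilsonFinTorusTwistedPartition ρ β (Function.update (1 : Fin 4 → G) 0 c) L L L T =
      ∫ V : Fin (1 + (n + n) + 1) → (FinSpatialSite T L L × Fin 3 → G),
        K (Tw (V 0)) (V 1) * ∏ t : Fin (1 + (n + n)), K (V t.succ) (V (t.succ + 1)) ∂(Measure.pi fun _ => μ) := by
    rw [wilsonFinTorusTwistedPartition_swap03_update ρ hρ β c L L L T, hcinv]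
    have h := wilsonFinTorusTwistedPartition_add_two_eq_integral_cyclic ρ hρ β hzc T L L (n + n)
    rw [show n + n + 2 = L by omega] at h
    exact h
  -- positivity of `Z` and division
  have hZpos : 0 < wilsonFinTorusPartition ρ β T L L L := wilsonFinTorusPartition_pos hρ β T L L L
  have hZeq : wilsonFinTorusPartition ρ β L L L T = wilsonFinTorusPartition ρ β T L L L :=
    wilsonFinTorusPartition_swap03 ρ hρ β L L L T
  set Zr : ℝ := wilsonFinTorusPartition ρ β T L L L with hZr
  set x : ℝ := finTorusExpectation ρ β (fun V' : FinTorusSite T L L L × Fin 4 → G =>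
    mag (finTorusSlice V' 0) * mag (finTorusSlice V' p)) with hx
  set w : ℝ := finTorusExpectation ρ β (fun V' : FinTorusSite T L L L × Fin 4 → G => mag (finTorusSlice V' 0) ^ 2) with hw
  set Ztw : ℝ := wilsonFinTorusTwistedPartition ρ β (Function.update (1 : Fin 4 → G) 0 c) L L L T with hZtw'
  rw [← hZ, ← hX, ← hW, ← hZtw] at hsec
  -- `hsec : (Z x)² ≤ 2 B² (Z w) (Z − Ztw)`; divide by `Z²`
  rw [hZeq]
  have hB : (2 : ℝ) * ((N : ℝ) * ((L : ℝ) * L)) ^ 2 * (Zr * w) * (Zr - Ztw) =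
      Zr ^ 2 * (2 * ((N : ℝ) * ((L : ℝ) * L)) ^ 2 * w * (1 - Ztw / Zr)) := by
    field_simp
  rw [mul_pow, hB] at hsec
  exact le_of_mul_le_mul_left (by linarith [hsec]) (pow_pos hZpos 2)

end SectorStep

/-! ## Step B — Borgs–Seiler's finite-volume bounds feed the slice sums -/

section PolyakovStep

variable {G : Type} [Group G] [TopologicalSpace G] [IsTopologicalGroup G] [CompactSpace G] [MeasurableSpace G] [BorelSpace G]
  [SecondCountableTopology G] {N : ℕ} (ρ : G →* Matrix (Fin N) (Fin N) ℂ)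

/-- `G_L` is even: `G_L(−x) = G_L(x)` (Hermitian symmetry and translation invariance of the Polyakov kernel). -/
theorem polyakovCorrelation_neg (hρ : Continuous ρ) (JE JM : ℝ) {L T : ℕ} [NeZero L] [NeZero T] (x : Fin 3 → ZMod L) :
    polyakovCorrelation (L₀ := T) ρ JE JM (-x) = polyakovCorrelation (L₀ := T) ρ JE JM x := by
  rw [polyakovCorrelation_eq_re_polyakovKernel ρ hρ, polyakovCorrelation_eq_re_polyakovKernel ρ hρ]
  have h1 : polyakovKernel (L₀ := T) ρ JE JM 0 (-x) = polyakovKernel (L₀ := T) ρ JE JM x 0 := by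
    have h := polyakovKernel_add (L₀ := T) ρ JE JM 0 (-x) x
    rw [zero_add, neg_add_cancel] at h
    exact h.symm
  rw [h1, ← conj_polyakovKernel ρ JE JM 0 x, Complex.conj_re]

/-- **The rate is non-negative**: `f = (1 + 2N/β)^T − 1 ≥ 0` for `β > 0`. -/
theorem borgsSeilerRate_nonneg (N T : ℕ) {β : ℝ} (hβ : 0 < β) : 0 ≤ borgsSeilerRate N T β := by
  unfold borgsSeilerRate
  have h : (1 : ℝ) ≤ 1 + 2 * (N : ℝ) / β := by
    have : (0 : ℝ) ≤ 2 * (N : ℝ) / β := by positivity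
    linarith
  linarith [one_le_pow₀ (n := T) h]

/-- **Step B (Borgs–Seiler side).**  For continuous faithful unitary `N`-dimensional `ρ` (`N ≥ 1`) with real characters, `β > 0`,
the even spatial side `L = 2n + 2` and any temporal extent `T ≥ 1`, with `G_L` the Polyakov two-point function of the box
`(ℤ/L)³ × ℤ_T`, `f = (1 + 2N/β)^T − 1` and `A = L⁻¹ Re Ĝ_L(0)` (`= L² m²`):
`A ≥ L²(1 − 39f/8)`,  `⟨m(𝒰₀) m(𝒰_{n+1})⟩ ≥ L²(A − fL²/8)`,  `⟨m(𝒰₀)²⟩ ≤ L²(A + fL²/8)` (expectations in the exchanged box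
`T × L × L × L`). -/
theorem polyakov_sliceSum_bounds (hρ : Continuous ρ) (hρu : ∀ g, ρ g ∈ Matrix.unitaryGroup (Fin N) ℂ)
    (hinj : Function.Injective ρ) (hN : 1 ≤ N) (hreal : ∀ g, (ρ g).trace.im = 0) {β : ℝ} (hβ : 0 < β) {n : ℕ} (hn : 1 ≤ n)
    (T : ℕ) [NeZero T] :
    ((n + 1 + n + 1 : ℕ) : ℝ) ^ 2 * (1 - 39 / 8 * borgsSeilerRate N T β) ≤
        ((n + 1 + n + 1 : ℕ) : ℝ)⁻¹ * (torusFourier (fun x : TorusSite 3 (n + 1 + n + 1) =>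
          (polyakovCorrelation (L₀ := T) ρ β β x : ℂ)) 0).re ∧
      ((n + 1 + n + 1 : ℕ) : ℝ) ^ 2 * (((n + 1 + n + 1 : ℕ) : ℝ)⁻¹ * (torusFourier (fun x : TorusSite 3 (n + 1 + n + 1) =>
          (polyakovCorrelation (L₀ := T) ρ β β x : ℂ)) 0).re -
            borgsSeilerRate N T β * ((n + 1 + n + 1 : ℕ) : ℝ) ^ 2 / 8) ≤
        finTorusExpectation ρ β (fun V' : FinTorusSite T (n + 1 + n + 1) (n + 1 + n + 1) (n + 1 + n + 1) × Fin 4 → G =>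
          finSliceMagnetisation ρ (finTorusSlice V' 0) *
            finSliceMagnetisation ρ (finTorusSlice V' ⟨n + 1, by omega⟩)) ∧
      finTorusExpectation ρ β (fun V' : FinTorusSite T (n + 1 + n + 1) (n + 1 + n + 1) (n + 1 + n + 1) × Fin 4 → G =>
          finSliceMagnetisation ρ (finTorusSlice V' 0) ^ 2) ≤
        ((n + 1 + n + 1 : ℕ) : ℝ) ^ 2 * (((n + 1 + n + 1 : ℕ) : ℝ)⁻¹ * (torusFourier (fun x : TorusSite 3 (n + 1 + n + 1) =>
          (polyakovCorrelation (L₀ := T) ρ β β x : ℂ)) 0).re +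
            borgsSeilerRate N T β * ((n + 1 + n + 1 : ℕ) : ℝ) ^ 2 / 8) := by
  have hL4 : 4 ≤ n + 1 + n + 1 := by omega
  have hLev : Even (n + 1 + n + 1) := ⟨n + 1, by omega⟩
  haveI : NeZero (n + 1 + n + 1) := ⟨by omega⟩
  set L : ℕ := n + 1 + n + 1 with hL
  set f : ℝ := borgsSeilerRate N T β with hf
  set Gf : TorusSite 3 L → ℝ := fun x => polyakovCorrelation (L₀ := T) ρ β β x with hGf
  have hLpos : (0 : ℝ) < L := by positivity
  have hf0 : 0 ≤ f := borgsSeilerRate_nonneg N T hβ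
  -- Borgs–Seiler's finite-volume infrared bound at this `L` (even, `≥ 4`), its positivity and its diagonal bound
  have hIR := BorgsSeilerInfraredBoundExplicit_holds G N 3 T ρ hN hρ hinj hρu L hLev hL4 β β hβ hβ
  have hpos : ∀ k : TorusSite 3 L, 0 ≤ (torusFourier (fun x => (Gf x : ℂ)) k).re :=
    Literature.Probability.LatticeModels.torusFourier_re_nonneg_of_posSemidef Gf (polyakovCorrelation_posSemidef ρ hρ β β)
  have heven : ∀ x, Gf (-x) = Gf x := fun x => polyakovCorrelation_neg ρ hρ β β x
  have hdiag : (1 : ℝ) ≤ Gf 0 := one_le_polyakovCorrelation_zero ρ hρu hρ (Nat.one_le_iff_ne_zero.mp hN) hβ.le β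
  have hIR0 : ∀ a : ZMod L, a ≠ 0 →
      (1 - Real.cos (2 * Real.pi * (a.val : ℝ) / L)) * (torusFourier (fun x => (Gf x : ℂ)) (Fin.cons a 0)).re ≤ f := by
    intro a ha
    have hk : (Fin.cons a (0 : TorusSite 2 L) : TorusSite 3 L) ≠ 0 := fun h => ha ((cons_zero_eq_zero_iff a).1 h)
    have h := hIR (Fin.cons a 0) 0 hk
    simpa [latticeMomentum] using h
  have hIR3 : ∀ k : TorusSite 3 L, k ≠ 0 → dispersion (latticeMomentum L k) * (torusFourier (fun x => (Gf x : ℂ)) k).re ≤ 3 * f := by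
    intro k hk
    calc dispersion (latticeMomentum L k) * (torusFourier (fun x => (Gf x : ℂ)) k).re
        = ∑ i : Fin 3, (1 - Real.cos (latticeMomentum L k i)) * (torusFourier (fun x => (Gf x : ℂ)) k).re := by
          rw [Literature.Probability.LatticeModels.dispersion, Finset.sum_mul]
      _ ≤ ∑ _i : Fin 3, f := Finset.sum_le_sum fun i _ => hIR k i hk
      _ = 3 * f := by simp
  -- (i) the zero mode: sum rule + diagonal bound + `torusGreen 0 ≤ 13/8`
  have hzero := Literature.Probability.LatticeModels.sub_mul_torusGreen_le_zeroMode Gf hIR3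
  have htG := torusGreen_zero_le (L := L)
  have hA : (L : ℝ) ^ 2 * (1 - 39 / 8 * f) ≤ (L : ℝ)⁻¹ * (torusFourier (fun x => (Gf x : ℂ)) 0).re := by
    have h1 : 1 - 3 * f * (13 / 8) ≤ ((L : ℝ) ^ 3)⁻¹ * (torusFourier (fun x => (Gf x : ℂ)) 0).re := by
      have : 3 * f * torusGreen (0 : TorusSite 3 L) ≤ 3 * f * (13 / 8) := mul_le_mul_of_nonneg_left htG (by positivity)
      linarith
    have h2 : (L : ℝ)⁻¹ * (torusFourier (fun x => (Gf x : ℂ)) 0).re =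
        (L : ℝ) ^ 2 * (((L : ℝ) ^ 3)⁻¹ * (torusFourier (fun x => (Gf x : ℂ)) 0).re) := by
      field_simp
    rw [h2]
    have : (L : ℝ) ^ 2 * (1 - 39 / 8 * f) = (L : ℝ) ^ 2 * (1 - 3 * f * (13 / 8)) := by ring
    rw [this]
    exact mul_le_mul_of_nonneg_left h1 (by positivity)
  refine ⟨hA, ?_, ?_⟩
  · -- (ii) the antipodal correlation
    rw [finTorusExpectation_finSliceMagnetisation_mul ρ hρ hρu hreal β]
    exact mul_le_mul_of_nonneg_left (le_sliceSum Gf hf0 hpos heven hIR0 _) (by positivity)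
  · -- (iii) the second moment
    have hsq : (fun V' : FinTorusSite T L L L × Fin 4 → G => finSliceMagnetisation ρ (finTorusSlice V' 0) ^ 2) =
        fun V' => finSliceMagnetisation ρ (finTorusSlice V' 0) * finSliceMagnetisation ρ (finTorusSlice V' 0) := by
      funext V'; ring
    rw [hsq, finTorusExpectation_finSliceMagnetisation_mul ρ hρ hρu hreal β]
    refine mul_le_mul_of_nonneg_left ?_ (by positivity)
    have h0 : (ZMod.finEquiv L) (0 : Fin L) = 0 := map_zero _
    rw [h0]
    exact sliceSum_zero_le Gf hf0 hIR0

end PolyakovStep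

/-! ## Step C — the window inequality -/

section Window

/-- Real-number core of the window: from the sector inequality `x² ≤ 2B²w(1 − r)`, a lower bound `0 < x₀ ≤ x` and an upper
bound `0 ≤ w ≤ w₀` one gets `r ≤ 1 − x₀²/(2B²w₀)`. -/
theorem ratio_le_of_sector_ineq {x w r B x₀ w₀ : ℝ} (hB : 0 < B) (hx₀ : 0 < x₀) (hx : x₀ ≤ x) (hw0 : 0 ≤ w) (hw : w ≤ w₀)
    (hsec : x ^ 2 ≤ 2 * B ^ 2 * w * (1 - r)) : r ≤ 1 - x₀ ^ 2 / (2 * B ^ 2 * w₀) := by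
  have hx2 : x₀ ^ 2 ≤ x ^ 2 := pow_le_pow_left₀ hx₀.le hx 2
  have hx₀2 : 0 < x₀ ^ 2 := by positivity
  have hkey : x₀ ^ 2 ≤ 2 * B ^ 2 * w * (1 - r) := hx2.trans hsec
  have hwpos : 0 < w := by
    rcases hw0.lt_or_eq with h | h
    · exact h
    · rw [← h] at hkey; nlinarith
  have hw₀pos : 0 < w₀ := lt_of_lt_of_le hwpos hw
  have h1 : x₀ ^ 2 / (2 * B ^ 2 * w) ≤ 1 - r := by
    rw [div_le_iff₀ (by positivity)]
    linarith
  have h2 : x₀ ^ 2 / (2 * B ^ 2 * w₀) ≤ x₀ ^ 2 / (2 * B ^ 2 * w) :=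
    div_le_div_of_nonneg_left hx₀2.le (by positivity) (by nlinarith [hB])
  linarith

/-- Monotonicity of `A ↦ (A − e)²/(A + e)` on `A ≥ A₀ > e ≥ 0`. -/
theorem sq_div_mono {A A₀ e : ℝ} (he : 0 ≤ e) (hA₀ : e < A₀) (h : A₀ ≤ A) :
    (A₀ - e) ^ 2 / (A₀ + e) ≤ (A - e) ^ 2 / (A + e) := by
  have h1 : 0 < A₀ + e := by linarith
  have h2 : 0 < A + e := by linarith
  rw [div_le_div_iff₀ h1 h2]
  nlinarith [mul_nonneg (sub_nonneg.2 h) (mul_nonneg (sub_nonneg.2 hA₀.le) (by linarith : (0:ℝ) ≤ A₀ + 3 * e)),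
    mul_nonneg (mul_nonneg (sub_nonneg.2 h) (sub_nonneg.2 h)) h1.le]

variable {G : Type} [Group G] [TopologicalSpace G] [IsTopologicalGroup G] [CompactSpace G] [MeasurableSpace G] [BorelSpace G]
  [SecondCountableTopology G] {N : ℕ} (ρ : G →* Matrix (Fin N) (Fin N) ℂ)

/-- Expectations of squares are non-negative. -/
theorem finTorusExpectation_sq_nonneg (hρ : Continuous ρ) (β : ℝ) {n₀ n₁ n₂ n₃ : ℕ}
    (Φ : (FinTorusSite n₀ n₁ n₂ n₃ × Fin 4 → G) → ℝ) : 0 ≤ finTorusExpectation ρ β (fun V => Φ V ^ 2) := by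
  rw [finTorusExpectation_eq_div]
  exact div_nonneg (integral_nonneg fun V => mul_nonneg (sq_nonneg _) (finTorusTwistedWeight_pos ρ β 1 V).le)
    (wilsonFinTorusPartition_pos hρ β n₀ n₁ n₂ n₃).le

/-- **MAIN — the heavy-twist window inequality (heavy-twist RUNG 2 engine).**  Compact `G`, continuous faithful unitary
`N`-dimensional `ρ` (`N ≥ 1`) with real characters, a central `c` with `ρ(c) = −1` and `c² = 1`, `β > 0`, an EVEN spatial side
`L = 2n + 2 ≥ 4` and any temporal extent `T ≥ 1` with `5f < 1`, `f = (1 + 2N/β)^T − 1` (Borgs–Seiler's rate):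
`Z^{(c on (0,3))}_β(L,L,L,T) / Z_β(L,L,L,T) ≤ 1 − (1 − 5f)²/(2N²(1 − 19f/4))`. -/
theorem twistRatio_le_of_rate (hρ : Continuous ρ) (hρu : ∀ g, ρ g ∈ Matrix.unitaryGroup (Fin N) ℂ) (hinj : Function.Injective ρ)
    (hN : 1 ≤ N) (hreal : ∀ g, (ρ g).trace.im = 0) {c : G} (hc : c ∈ Subgroup.center G) (hρc : ρ c = -1) (hcc : c * c = 1)
    {β : ℝ} (hβ : 0 < β) {n : ℕ} (hn : 1 ≤ n) (T : ℕ) [NeZero T] (h5f : 5 * borgsSeilerRate N T β < 1) :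
    wilsonFinTorusTwistedPartition ρ β (Function.update (1 : Fin 4 → G) 0 c) (n + 1 + n + 1) (n + 1 + n + 1) (n + 1 + n + 1) T /
        wilsonFinTorusPartition ρ β (n + 1 + n + 1) (n + 1 + n + 1) (n + 1 + n + 1) T ≤
      1 - (1 - 5 * borgsSeilerRate N T β) ^ 2 / (2 * (N : ℝ) ^ 2 * (1 - 19 / 4 * borgsSeilerRate N T β)) := by
  obtain ⟨hA, hx, hw⟩ := polyakov_sliceSum_bounds ρ hρ hρu hinj hN hreal hβ hn T
  have hsec := sq_corr_le_of_sector ρ hρ hρu hc hρc hcc β n T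
  set L : ℕ := n + 1 + n + 1 with hL
  set f : ℝ := borgsSeilerRate N T β with hf
  set A : ℝ := ((L : ℕ) : ℝ)⁻¹ * (torusFourier (fun x : TorusSite 3 L => (polyakovCorrelation (L₀ := T) ρ β β x : ℂ)) 0).re
    with hAdef
  have hf0 : 0 ≤ f := borgsSeilerRate_nonneg N T hβ
  have hLpos : (0 : ℝ) < L := by rw [hL]; positivity
  have hL2 : (0 : ℝ) < (L : ℝ) ^ 2 := by positivity
  have hN0 : (0 : ℝ) < N := by exact_mod_cast hN
  -- the lower bound `x₀ = L²(A − fL²/8) ≥ L⁴(1 − 5f) > 0` and the upper bound `w₀ = L²(A + fL²/8)`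
  have he : (0 : ℝ) ≤ f * (L : ℝ) ^ 2 / 8 := by positivity
  have hA₀e : f * (L : ℝ) ^ 2 / 8 < (L : ℝ) ^ 2 * (1 - 39 / 8 * f) := by nlinarith
  have hx₀ : 0 < (L : ℝ) ^ 2 * (A - f * (L : ℝ) ^ 2 / 8) := by nlinarith
  have hw0 := finTorusExpectation_sq_nonneg ρ hρ β
    (fun V' : FinTorusSite T L L L × Fin 4 → G => finSliceMagnetisation ρ (finTorusSlice V' 0))
  have hB : (0 : ℝ) < (N : ℝ) * ((L : ℝ) * L) := by positivity
  have hr := ratio_le_of_sector_ineq hB hx₀ hx hw0 hw hsec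
  -- compare the explicit bound with the target by monotonicity in `A`
  have hmono := sq_div_mono he hA₀e hA
  have ht₂ : (0 : ℝ) < 1 - 19 / 4 * f := by nlinarith
  have hAe : 0 < A + f * (L : ℝ) ^ 2 / 8 := by linarith
  have e0 : (L : ℝ) ^ 2 * (1 - 39 / 8 * f) - f * (L : ℝ) ^ 2 / 8 = (L : ℝ) ^ 2 * (1 - 5 * f) := by ring
  have e0' : (L : ℝ) ^ 2 * (1 - 39 / 8 * f) + f * (L : ℝ) ^ 2 / 8 = (L : ℝ) ^ 2 * (1 - 19 / 4 * f) := by ring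
  rw [e0, e0'] at hmono
  -- `target = [(L²(1−5f))²/(L²(1−19f/4))] / (2N²L²)` and `bound = [(A−e)²/(A+e)] / (2N²L²)`
  have eT : (1 - 5 * f) ^ 2 / (2 * (N : ℝ) ^ 2 * (1 - 19 / 4 * f)) =
      ((L : ℝ) ^ 2 * (1 - 5 * f)) ^ 2 / ((L : ℝ) ^ 2 * (1 - 19 / 4 * f)) / (2 * (N : ℝ) ^ 2 * (L : ℝ) ^ 2) := by
    field_simp
  have eB : ((L : ℝ) ^ 2 * (A - f * (L : ℝ) ^ 2 / 8)) ^ 2 /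
        (2 * ((N : ℝ) * ((L : ℝ) * L)) ^ 2 * ((L : ℝ) ^ 2 * (A + f * (L : ℝ) ^ 2 / 8))) =
      (A - f * (L : ℝ) ^ 2 / 8) ^ 2 / (A + f * (L : ℝ) ^ 2 / 8) / (2 * (N : ℝ) ^ 2 * (L : ℝ) ^ 2) := by
    field_simp
  have hcmp : (1 - 5 * f) ^ 2 / (2 * (N : ℝ) ^ 2 * (1 - 19 / 4 * f)) ≤
      ((L : ℝ) ^ 2 * (A - f * (L : ℝ) ^ 2 / 8)) ^ 2 /
        (2 * ((N : ℝ) * ((L : ℝ) * L)) ^ 2 * ((L : ℝ) ^ 2 * (A + f * (L : ℝ) ^ 2 / 8))) := by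
    rw [eT, eB]
    exact div_le_div_of_nonneg_right hmono (by positivity)
  have hcast : (((n + 1 + n + 1 : ℕ) : ℝ)) = (L : ℝ) := by rw [hL]
  rw [hcast] at hr
  linarith

end Window

end Summit.QuantumFields.YangMills.Cruxes.IR.HeavyTwistWall

end
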